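import Summits.QuantumFields.YangMills.Theorems.FluctuationComparisonRegPrIntLOrganTangentFibreWeightNormalisation
import Literature.Probability.Divergences.TiltedPathEventBound
import HarnessLib

/-!
# Route `UnitScaleTilt` — crux `FluctuationComparisonRegPrIntL` (stmt-QuantumFields-20520, rung R3), PATH-B organ: «THE GOOD-SET TAIL ALONG THE PATH» —
# the `ŵ_t`-mass of any fibre event is at most the larger of its `ŵ₀`- and `ŵ₁`-masses times `exp(min(t·J₀, (1−t)·J₁))` (SPEC (xv-b) «A5 TAIL THRESHOLD»)

Cell `ym3-torus` (YM ladder rung R3 = continuum `SU(2)` Yang–Mills on the three-torus — a RUNG: NOT d = 4, NOT infinite volume, NOT a mass gap, NOT Clay).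
Width seat `ym-ust-20520-w4` (gen 26); corollary named and WANTED by LEAD `ym-ust-20520-w3` g28 №60 (owner of DISCHARGE-SPEC item (xv-b)); `--kind proof --supports
stmt-QuantumFields-20520 --as helper`, count-neutral, DEFINITION-FREE, no registry ∕ binder ∕ `Lines/` edit, default heartbeats, `autoImplicit false`.

WHAT.  In the frame's letters (binders = ✓`…OrganTangentFibreWeightNormalisation.wgt_normalised`'s VERBATIM, then `t ∈ [0,1]`, a window point `V`, a measurable fibre
event `A`): with `h(z) := log ρ_Ts(Φ(V,z)) − log ρ′_Ts(Φ(V,z))`,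

  ★★`setIntegral_wgt_le_max_mul_exp`:
  `∫_A ŵ_t(V,·) dτ ≤ max(∫_A ŵ₀(V,·) dτ, ∫_A ŵ₁(V,·) dτ) · exp(min(t·J₀, (1−t)·J₁))`,
  `J₀ = log((∫wNum₁)∕∫wNum₀) − (∫ wNum₀·h)∕∫wNum₀`   (the Jensen gap of `h` under the law `ŵ₀`, `= log E₀e^{h} − E₀h ≥ 0`),
  `J₁ = log((∫wNum₀)∕∫wNum₁) + (∫ wNum₁·h)∕∫wNum₁`   (the Jensen gap of `−h` under `ŵ₁`),

`J₀, J₁` DISPLAYED as integrals (hypothesis-free: `wNum₀·h = (χ·ρ′·h)∘Φ·J` and `wNum₁·h = (χ·ρ·h)∘Φ·J` are bounded — `χ·g` is continuous on the compact field space for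
`g` continuous on the open `θ_Ts`-window, ✓`continuous_mul_of_support`, exactly as in ✓`wgt_normalised`'s proof — hence `τ`-integrable: §2).  Ingredients: §1 the
pointwise identities `wNum_t = wNum₀·e^{t h} = wNum₁·e^{(1−t)(−h)}` (`ρ^t ρ′^{1−t} = ρ′ e^{t h}` on the χ-support by `rpow_def_of_pos`, both sides `0` off it); §3 two calls of
the Literature lemma ✓`Literature.Probability.Divergences.weightedTiltedMass_le` (`TiltedPathEventBound`: Jensen for the concave power on `A` + Jensen for `exp` on the
normaliser; [Rudin1987] Thm 3.3 ∕ 3.5), with base weights `wNum₀` resp. `wNum₁`, and `a^{1−t} b^t ≤ max a b`.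

WHY (DISCHARGE-SPEC v1.9 ∕ v1.10 §11 (xv-b), LEAD RULINGS №58 ∕ №59, LEAD №60).  A5's Good-set clause asks `∫_{Goodᶜ} ŵ_t(Xw,·) dτ ≤ ES` for EVERY `t ∈ [0,1]`; only the
ENDPOINT laws `ŵ₀ ∝ χ·ρ′_Ts·J`, `ŵ₁ ∝ χ·ρ_Ts·J` are print's genuine conditional fibre laws (where [Balaban1985UV3] (71)-type large-field tails live); the interpolated law is
the organ's own artefact.  This file reduces the clause to «`Goodᶜ` is rare under `ŵ₀` AND under `ŵ₁`» plus ONE Jensen-gap letter `min(t·J₀, (1−t)·J₁)` — the Jensen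
lane's currency — with NO sup-norm of `h`.  It docks under A5 ∕ A5″'s `ES` slot without touching the row (ROW-sq v0.4ᴱ stays of record; an «endpoint tails» re-lettering of
the `Good` clause is a future option recorded by LEAD №60, not cut).

HONEST FRAMING: measure-theoretic [folklore] over the frame's letters; nothing of Bałaban's analysis ((71) included) is asserted or proved; (xv-b) is NOT discharged (its
endpoint tails and the `J`-letter remain to be supplied); `SpreadFibreLawHJ(sq)`(ᴱ) ∕ `OrganDischargeInputsHJ(sq)` (every edition) UNDISCHARGED; the five registered stubs
of `Lines/runpair_organ.lean` (registry 3732b7df, untouched), crux 20520 and `YM3TorusSU2` are NOT proved; rung R3 = SU(2) YM₃ on T³ at fixed lattice data — NOT d = 4,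
NOT infinite volume, NOT a mass gap, NOT Clay; the Yang–Mills mass gap is NOT proved.
-/

set_option autoImplicit false

noncomputable section

namespace Summit.QuantumFields.YangMills.Theorems.OrganTangentGoodSetTailAlongPath

open MeasureTheory Filter Topology
open scoped ENNReal NNReal
open Literature.MathematicalPhysics.QuantumFieldTheory.Balaban1983to89 T3ContinuumYM3Torus T3NestedUnitLaws
  T3UnitLawDensityEML T4Continuum T3UnitScaleTilt T3LevelShift T3TiltDescent
open Summit.QuantumFields.YangMills.BalabanUVNodes.N09DomAltThresholdNull (isOpen_setOf_plaqSmall_SU)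
open Literature.MathematicalPhysics.QuantumFieldTheory.Balaban1983to89.B12ContinuousTransportInvarianceOn (continuous_dist1_SU continuous_plaqHol_SU)
open Summit.QuantumFields.YangMills.Theorems.OrganTangentSigmaVersionChartMean (continuous_mul_of_support exists_abs_le_of_continuous)
open Summit.QuantumFields.YangMills.Theorems.FluctuationComparisonRegPrIntLRunpairOrganFibreLaw (mwCut wNum wgt)
open Summit.QuantumFields.YangMills.Theorems.OrganTangentFibreWeightNormalisation (wgt_normalised wNum_nonneg)
open Literature.Probability.Divergences (weightedTiltedMass_le)

/-! ## §1 The path is an exponential tilt: `wNum_t = wNum₀ · e^{t h} = wNum₁ · e^{(1−t)(−h)}` pointwise -/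

/-- On the χ-support both densities are positive, so `ρ^t·ρ′^{1−t} = ρ′·e^{t(log ρ − log ρ′)}`; off it both sides vanish:
`wNum_t(V,z) = wNum₀(V,z) · exp(t · (log ρ_Ts(Φ(V,z)) − log ρ′_Ts(Φ(V,z))))` for every real `t`. [folklore] -/
theorem wNum_eq_wNum_zero_mul_exp (F : T3Family) (γ b₀ p₀ : ℝ) (j Ts : ℕ) (hjTs : j + 1 ≤ Ts)
    (ρ ρ' : (i : ℕ) → GaugeField (F.P i) 0 ↥(Matrix.specialUnitaryGroup (Fin 2) ℂ) → ℝ)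
    (hρpos : ∀ U, PlaqSmall (θBal F.L γ b₀ p₀ Ts) U → 0 < ρ Ts U ∧ 0 < ρ' Ts U)
    (hθ : 0 < θBal F.L γ b₀ p₀ Ts)
    (hχsupp : ∀ U, mwCut F γ b₀ p₀ j Ts U ≠ 0 → ∀ (n : ℕ) (hjn : j + 1 ≤ n) (hnK : n ≤ Ts), PlaqSmall (24 / 25 * θBal F.L γ b₀ p₀ n) (descendTo F ℰp n Ts hnK U))
    {Z : Type} (Φ : GaugeField (F.P j) 0 ↥(Matrix.specialUnitaryGroup (Fin 2) ℂ) × Z → GaugeField (F.P Ts) 0 ↥(Matrix.specialUnitaryGroup (Fin 2) ℂ))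
    (J : GaugeField (F.P j) 0 ↥(Matrix.specialUnitaryGroup (Fin 2) ℂ) × Z → ℝ≥0)
    (t : ℝ) (V : GaugeField (F.P j) 0 ↥(Matrix.specialUnitaryGroup (Fin 2) ℂ)) (z : Z) :
    wNum F γ b₀ p₀ j Ts ρ ρ' Φ J t V z
      = wNum F γ b₀ p₀ j Ts ρ ρ' Φ J 0 V z * Real.exp (t * (Real.log (ρ Ts (Φ (V, z))) - Real.log (ρ' Ts (Φ (V, z))))) := by
  by_cases hχ : mwCut F γ b₀ p₀ j Ts (Φ (V, z)) = 0
  · simp only [wNum, hχ, zero_mul]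
  · have hW : PlaqSmall (θBal F.L γ b₀ p₀ Ts) (Φ (V, z)) := by
      intro p
      have h := hχsupp _ hχ Ts hjTs le_rfl p
      rw [T3DescentFibreTower.descendTo_self] at h
      exact lt_of_lt_of_le h (by linarith)
    have hρ := (hρpos _ hW).1
    have hρ' := (hρpos _ hW).2
    have hid : ρ Ts (Φ (V, z)) ^ t * ρ' Ts (Φ (V, z)) ^ (1 - t)
        = ρ' Ts (Φ (V, z)) * Real.exp (t * (Real.log (ρ Ts (Φ (V, z))) - Real.log (ρ' Ts (Φ (V, z))))) := by
      rw [Real.rpow_def_of_pos hρ, Real.rpow_def_of_pos hρ', ← Real.exp_add,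
        show ρ' Ts (Φ (V, z)) * Real.exp (t * (Real.log (ρ Ts (Φ (V, z))) - Real.log (ρ' Ts (Φ (V, z)))))
          = Real.exp (Real.log (ρ' Ts (Φ (V, z))) + t * (Real.log (ρ Ts (Φ (V, z))) - Real.log (ρ' Ts (Φ (V, z))))) by
            rw [Real.exp_add, Real.exp_log hρ']]
      congr 1; ring
    simp only [wNum, Real.rpow_eq_pow, Real.rpow_zero, sub_zero, Real.rpow_one, one_mul]
    rw [hid]; ring

/-- The same from the other end: `wNum_t(V,z) = wNum₁(V,z) · exp((1−t) · (−(log ρ_Ts(Φ(V,z)) − log ρ′_Ts(Φ(V,z)))))`. [folklore] -/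
theorem wNum_eq_wNum_one_mul_exp (F : T3Family) (γ b₀ p₀ : ℝ) (j Ts : ℕ) (hjTs : j + 1 ≤ Ts)
    (ρ ρ' : (i : ℕ) → GaugeField (F.P i) 0 ↥(Matrix.specialUnitaryGroup (Fin 2) ℂ) → ℝ)
    (hρpos : ∀ U, PlaqSmall (θBal F.L γ b₀ p₀ Ts) U → 0 < ρ Ts U ∧ 0 < ρ' Ts U)
    (hθ : 0 < θBal F.L γ b₀ p₀ Ts)
    (hχsupp : ∀ U, mwCut F γ b₀ p₀ j Ts U ≠ 0 → ∀ (n : ℕ) (hjn : j + 1 ≤ n) (hnK : n ≤ Ts), PlaqSmall (24 / 25 * θBal F.L γ b₀ p₀ n) (descendTo F ℰp n Ts hnK U))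
    {Z : Type} (Φ : GaugeField (F.P j) 0 ↥(Matrix.specialUnitaryGroup (Fin 2) ℂ) × Z → GaugeField (F.P Ts) 0 ↥(Matrix.specialUnitaryGroup (Fin 2) ℂ))
    (J : GaugeField (F.P j) 0 ↥(Matrix.specialUnitaryGroup (Fin 2) ℂ) × Z → ℝ≥0)
    (t : ℝ) (V : GaugeField (F.P j) 0 ↥(Matrix.specialUnitaryGroup (Fin 2) ℂ)) (z : Z) :
    wNum F γ b₀ p₀ j Ts ρ ρ' Φ J t V z
      = wNum F γ b₀ p₀ j Ts ρ ρ' Φ J 1 V z * Real.exp ((1 - t) * -(Real.log (ρ Ts (Φ (V, z))) - Real.log (ρ' Ts (Φ (V, z))))) := by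
  by_cases hχ : mwCut F γ b₀ p₀ j Ts (Φ (V, z)) = 0
  · simp only [wNum, hχ, zero_mul]
  · have hW : PlaqSmall (θBal F.L γ b₀ p₀ Ts) (Φ (V, z)) := by
      intro p
      have h := hχsupp _ hχ Ts hjTs le_rfl p
      rw [T3DescentFibreTower.descendTo_self] at h
      exact lt_of_lt_of_le h (by linarith)
    have hρ := (hρpos _ hW).1
    have hρ' := (hρpos _ hW).2
    have hid : ρ Ts (Φ (V, z)) ^ t * ρ' Ts (Φ (V, z)) ^ (1 - t)
        = ρ Ts (Φ (V, z)) * Real.exp ((1 - t) * -(Real.log (ρ Ts (Φ (V, z))) - Real.log (ρ' Ts (Φ (V, z))))) := by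
      rw [Real.rpow_def_of_pos hρ, Real.rpow_def_of_pos hρ', ← Real.exp_add,
        show ρ Ts (Φ (V, z)) * Real.exp ((1 - t) * -(Real.log (ρ Ts (Φ (V, z))) - Real.log (ρ' Ts (Φ (V, z)))))
          = Real.exp (Real.log (ρ Ts (Φ (V, z))) + (1 - t) * -(Real.log (ρ Ts (Φ (V, z))) - Real.log (ρ' Ts (Φ (V, z))))) by
            rw [Real.exp_add, Real.exp_log hρ]]
      congr 1; ring
    simp only [wNum, Real.rpow_eq_pow, Real.rpow_zero, sub_self, Real.rpow_one, mul_one]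
    rw [hid]; ring

/-! ## §2 `wNum_s · h` is integrable for `s = 0, 1` (boundedness of `χ·ρ′·h`, `χ·ρ·h` on the compact field space) -/

/-- For `g` continuous on the open `θ_Ts`-window: `z ↦ χ(Φ(V,z))·g(Φ(V,z))·J(V,z)` is bounded and `τ`-integrable (`χ·g` is continuous on the compact field space since
`supp χ` sits in the closed `24∕25`-window inside the open window — the device of ✓`wgt_normalised`). [folklore] -/
theorem integrable_mwCut_mul_comp_mul (F : T3Family) (γ b₀ p₀ : ℝ) (j Ts : ℕ) (hjTs : j + 1 ≤ Ts)
    (hθ : 0 < θBal F.L γ b₀ p₀ Ts)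
    (hχc : Continuous (mwCut F γ b₀ p₀ j Ts))
    (hχsupp : ∀ U, mwCut F γ b₀ p₀ j Ts U ≠ 0 → ∀ (n : ℕ) (hjn : j + 1 ≤ n) (hnK : n ≤ Ts), PlaqSmall (24 / 25 * θBal F.L γ b₀ p₀ n) (descendTo F ℰp n Ts hnK U))
    {Z : Type} [MeasurableSpace Z] (τ : Measure Z) [IsProbabilityMeasure τ]
    (Φ : GaugeField (F.P j) 0 ↥(Matrix.specialUnitaryGroup (Fin 2) ℂ) × Z → GaugeField (F.P Ts) 0 ↥(Matrix.specialUnitaryGroup (Fin 2) ℂ))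
    (J : GaugeField (F.P j) 0 ↥(Matrix.specialUnitaryGroup (Fin 2) ℂ) × Z → ℝ≥0)
    (hΦm : Measurable Φ) (hJm : Measurable J) (CJ : ℝ) (hJle : ∀ V z, (J (V, z) : ℝ) ≤ CJ)
    (g : GaugeField (F.P Ts) 0 ↥(Matrix.specialUnitaryGroup (Fin 2) ℂ) → ℝ) (hg : ContinuousOn g {U | PlaqSmall (θBal F.L γ b₀ p₀ Ts) U})
    (V : GaugeField (F.P j) 0 ↥(Matrix.specialUnitaryGroup (Fin 2) ℂ)) :
    Integrable (fun z => mwCut F γ b₀ p₀ j Ts (Φ (V, z)) * g (Φ (V, z)) * (J (V, z) : ℝ)) τ := by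
  classical
  haveI : CompactSpace (GaugeField (F.P Ts) 0 ↥(Matrix.specialUnitaryGroup (Fin 2) ℂ)) :=
    inferInstanceAs (CompactSpace (PBond (F.P Ts) 0 → ↥(Matrix.specialUnitaryGroup (Fin 2) ℂ)))
  haveI : BorelSpace (GaugeField (F.P Ts) 0 ↥(Matrix.specialUnitaryGroup (Fin 2) ℂ)) :=
    Literature.MathematicalPhysics.QuantumFieldTheory.Balaban1983to89.T3OrbitAverage.instBorelSpaceGaugeField
  set C : Set (GaugeField (F.P Ts) 0 ↥(Matrix.specialUnitaryGroup (Fin 2) ℂ)) :=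
    {U | ∀ p, dist1 (GaugeField.plaqHol U p) ≤ 24 / 25 * θBal F.L γ b₀ p₀ Ts} with hC
  have hCclosed : IsClosed C := by
    have : C = ⋂ p, {U | dist1 (GaugeField.plaqHol U p) ≤ 24 / 25 * θBal F.L γ b₀ p₀ Ts} := by
      ext U; simp only [hC, Set.mem_setOf_eq, Set.mem_iInter]
    rw [this]
    exact isClosed_iInter fun p => isClosed_le ((continuous_dist1_SU (N := 2)).comp (continuous_plaqHol_SU (N := 2) p)) continuous_const
  have hO : IsOpen {U : GaugeField (F.P Ts) 0 ↥(Matrix.specialUnitaryGroup (Fin 2) ℂ) | PlaqSmall (θBal F.L γ b₀ p₀ Ts) U} :=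
    isOpen_setOf_plaqSmall_SU 2 _ _ _
  have hCO : C ⊆ {U | PlaqSmall (θBal F.L γ b₀ p₀ Ts) U} := by
    intro U hU p
    exact lt_of_le_of_lt (hU p) (by linarith)
  have hχC : ∀ U, mwCut F γ b₀ p₀ j Ts U ≠ 0 → U ∈ C := by
    intro U hU p
    have h := hχsupp U hU Ts hjTs le_rfl p
    rw [T3DescentFibreTower.descendTo_self] at h
    exact le_of_lt h
  have hfc : Continuous fun U => mwCut F γ b₀ p₀ j Ts U * g U := continuous_mul_of_support hO hCclosed hCO hχc hχC hg
  obtain ⟨M, hM⟩ := exists_abs_le_of_continuous hfc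
  have hΦm1 : Measurable fun z => Φ (V, z) := hΦm.comp (measurable_const.prodMk measurable_id)
  have hJm1 : Measurable fun z => (J (V, z) : ℝ) := (hJm.comp (measurable_const.prodMk measurable_id)).coe_nnreal_real
  have hfm : Measurable fun z => mwCut F γ b₀ p₀ j Ts (Φ (V, z)) * g (Φ (V, z)) := hfc.measurable.comp hΦm1
  refine Integrable.mono' (integrable_const (M * CJ)) ((hfm.mul hJm1).aestronglyMeasurable) (Eventually.of_forall fun z => ?_)
  rw [Real.norm_eq_abs, abs_mul, abs_of_nonneg (NNReal.coe_nonneg _)]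
  have hM0 : 0 ≤ M := (abs_nonneg _).trans (hM (Φ (V, z)))
  exact mul_le_mul (hM _) (hJle V z) (NNReal.coe_nonneg _) hM0

/-! ## §3 The Good-set tail along the path -/

/-- ★★ **THE GOOD-SET TAIL ALONG THE PATH** — in the frame's letters (binders of ✓`wgt_normalised`, then `t ∈ [0,1]`, a window point `V`, a measurable fibre event `A`),
with `h(z) = log ρ_Ts(Φ(V,z)) − log ρ′_Ts(Φ(V,z))`:
`∫_A ŵ_t(V,·) dτ ≤ max(∫_A ŵ₀(V,·) dτ, ∫_A ŵ₁(V,·) dτ) · exp(min(t·J₀, (1−t)·J₁))`, where `J₀ = log((∫wNum₁)∕∫wNum₀) − (∫wNum₀·h)∕∫wNum₀` and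
`J₁ = log((∫wNum₀)∕∫wNum₁) + (∫wNum₁·h)∕∫wNum₁` are the Jensen gaps of `h` under `ŵ₀` and of `−h` under `ŵ₁`, displayed as integrals.  Two calls of
✓`Literature.Probability.Divergences.weightedTiltedMass_le`. [cite: Rudin1987, Thm 3.3 p. 62 and Thm 3.5 p. 63] -/
theorem setIntegral_wgt_le_max_mul_exp (F : T3Family) (γ b₀ p₀ : ℝ) (j Ts : ℕ) (hjTs : j + 1 ≤ Ts)
    (ρ ρ' : (i : ℕ) → GaugeField (F.P i) 0 ↥(Matrix.specialUnitaryGroup (Fin 2) ℂ) → ℝ)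
    (hρm : Measurable (ρ Ts)) (hρ'm : Measurable (ρ' Ts))
    (hρc : ContinuousOn (ρ Ts) {U | PlaqSmall (θBal F.L γ b₀ p₀ Ts) U}) (hρ'c : ContinuousOn (ρ' Ts) {U | PlaqSmall (θBal F.L γ b₀ p₀ Ts) U})
    (hρpos : ∀ U, PlaqSmall (θBal F.L γ b₀ p₀ Ts) U → 0 < ρ Ts U ∧ 0 < ρ' Ts U)
    (hθ : 0 < θBal F.L γ b₀ p₀ Ts)
    (hχc : Continuous (mwCut F γ b₀ p₀ j Ts)) (hχ0 : ∀ U, 0 ≤ mwCut F γ b₀ p₀ j Ts U)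
    (hχsupp : ∀ U, mwCut F γ b₀ p₀ j Ts U ≠ 0 → ∀ (n : ℕ) (hjn : j + 1 ≤ n) (hnK : n ≤ Ts), PlaqSmall (24 / 25 * θBal F.L γ b₀ p₀ n) (descendTo F ℰp n Ts hnK U))
    (hχpos : ∀ U, (∀ (n : ℕ) (hjn : j + 1 ≤ n) (hnK : n ≤ Ts), PlaqSmall (24 / 25 * θBal F.L γ b₀ p₀ n) (descendTo F ℰp n Ts hnK U)) → 0 < mwCut F γ b₀ p₀ j Ts U)
    {Z : Type} [MeasurableSpace Z] (τ : Measure Z) [IsProbabilityMeasure τ]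
    (Φ : GaugeField (F.P j) 0 ↥(Matrix.specialUnitaryGroup (Fin 2) ℂ) × Z → GaugeField (F.P Ts) 0 ↥(Matrix.specialUnitaryGroup (Fin 2) ℂ))
    (J : GaugeField (F.P j) 0 ↥(Matrix.specialUnitaryGroup (Fin 2) ℂ) × Z → ℝ≥0)
    (hΦm : Measurable Φ) (hJm : Measurable J) (CJ : ℝ) (hJle : ∀ V z, (J (V, z) : ℝ) ≤ CJ)
    (hpos : ∀ V, PlaqSmall (θBal F.L γ b₀ p₀ j) V →
      0 < ∫⁻ z in {z | (∀ (n : ℕ) (hjn : j + 1 ≤ n) (hnK : n ≤ Ts), PlaqSmall (24 / 25 * θBal F.L γ b₀ p₀ n) (descendTo F ℰp n Ts hnK (Φ (V, z))))},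
        (J (V, z) : ℝ≥0∞) ∂τ)
    (t : ℝ) (ht0 : 0 ≤ t) (ht1 : t ≤ 1)
    (V : GaugeField (F.P j) 0 ↥(Matrix.specialUnitaryGroup (Fin 2) ℂ)) (hV : PlaqSmall (θBal F.L γ b₀ p₀ j) V)
    {A : Set Z} (hA : MeasurableSet A) :
    ∫ z in A, wgt F γ b₀ p₀ j Ts ρ ρ' τ Φ J t V z ∂τ
      ≤ max (∫ z in A, wgt F γ b₀ p₀ j Ts ρ ρ' τ Φ J 0 V z ∂τ) (∫ z in A, wgt F γ b₀ p₀ j Ts ρ ρ' τ Φ J 1 V z ∂τ)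
        * Real.exp (min
            (t * (Real.log ((∫ z, wNum F γ b₀ p₀ j Ts ρ ρ' Φ J 1 V z ∂τ) / ∫ z, wNum F γ b₀ p₀ j Ts ρ ρ' Φ J 0 V z ∂τ)
                    - (∫ z, wNum F γ b₀ p₀ j Ts ρ ρ' Φ J 0 V z * (Real.log (ρ Ts (Φ (V, z))) - Real.log (ρ' Ts (Φ (V, z)))) ∂τ)
                        / ∫ z, wNum F γ b₀ p₀ j Ts ρ ρ' Φ J 0 V z ∂τ))
            ((1 - t) * (Real.log ((∫ z, wNum F γ b₀ p₀ j Ts ρ ρ' Φ J 0 V z ∂τ) / ∫ z, wNum F γ b₀ p₀ j Ts ρ ρ' Φ J 1 V z ∂τ)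
                    + (∫ z, wNum F γ b₀ p₀ j Ts ρ ρ' Φ J 1 V z * (Real.log (ρ Ts (Φ (V, z))) - Real.log (ρ' Ts (Φ (V, z)))) ∂τ)
                        / ∫ z, wNum F γ b₀ p₀ j Ts ρ ρ' Φ J 1 V z ∂τ))) := by
  classical
  haveI : BorelSpace (GaugeField (F.P Ts) 0 ↥(Matrix.specialUnitaryGroup (Fin 2) ℂ)) :=
    Literature.MathematicalPhysics.QuantumFieldTheory.Balaban1983to89.T3OrbitAverage.instBorelSpaceGaugeField
  -- abbreviations
  set h : Z → ℝ := fun z => Real.log (ρ Ts (Φ (V, z))) - Real.log (ρ' Ts (Φ (V, z))) with hh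
  have hN := wgt_normalised F γ b₀ p₀ j Ts hjTs ρ ρ' hρm hρ'm hρc hρ'c hρpos hθ hχc hχ0 hχsupp hχpos τ Φ J hΦm hJm CJ hJle hpos
  have hnn := wNum_nonneg F γ b₀ p₀ j Ts hjTs ρ ρ' hρpos hθ hχ0 hχsupp Φ J
  obtain ⟨hI0, hP0, -, -⟩ := hN 0 V hV
  obtain ⟨hI1, hP1, -, -⟩ := hN 1 V hV
  obtain ⟨hIt, hPt, -, -⟩ := hN t V hV
  -- pointwise identities (§1)
  have hpt0 : ∀ z, wNum F γ b₀ p₀ j Ts ρ ρ' Φ J t V z = wNum F γ b₀ p₀ j Ts ρ ρ' Φ J 0 V z * Real.exp (t * h z) :=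
    fun z => wNum_eq_wNum_zero_mul_exp F γ b₀ p₀ j Ts hjTs ρ ρ' hρpos hθ hχsupp Φ J t V z
  have hp10 : ∀ z, wNum F γ b₀ p₀ j Ts ρ ρ' Φ J 1 V z = wNum F γ b₀ p₀ j Ts ρ ρ' Φ J 0 V z * Real.exp (h z) := by
    intro z; have e := wNum_eq_wNum_zero_mul_exp F γ b₀ p₀ j Ts hjTs ρ ρ' hρpos hθ hχsupp Φ J 1 V z; rwa [one_mul] at e
  have hpt1 : ∀ z, wNum F γ b₀ p₀ j Ts ρ ρ' Φ J t V z = wNum F γ b₀ p₀ j Ts ρ ρ' Φ J 1 V z * Real.exp ((1 - t) * -h z) :=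
    fun z => wNum_eq_wNum_one_mul_exp F γ b₀ p₀ j Ts hjTs ρ ρ' hρpos hθ hχsupp Φ J t V z
  have hp01 : ∀ z, wNum F γ b₀ p₀ j Ts ρ ρ' Φ J 0 V z = wNum F γ b₀ p₀ j Ts ρ ρ' Φ J 1 V z * Real.exp (-h z) := by
    intro z; have e := wNum_eq_wNum_one_mul_exp F γ b₀ p₀ j Ts hjTs ρ ρ' hρpos hθ hχsupp Φ J 0 V z; rwa [sub_zero, one_mul] at e
  -- integrability of `wNum₀·h`, `wNum₁·h` (§2)
  have hg0 : ContinuousOn (fun U => ρ' Ts U * (Real.log (ρ Ts U) - Real.log (ρ' Ts U))) {U | PlaqSmall (θBal F.L γ b₀ p₀ Ts) U} :=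
    hρ'c.mul ((hρc.log fun U hU => (hρpos U hU).1.ne').sub (hρ'c.log fun U hU => (hρpos U hU).2.ne'))
  have hg1 : ContinuousOn (fun U => ρ Ts U * (Real.log (ρ Ts U) - Real.log (ρ' Ts U))) {U | PlaqSmall (θBal F.L γ b₀ p₀ Ts) U} :=
    hρc.mul ((hρc.log fun U hU => (hρpos U hU).1.ne').sub (hρ'c.log fun U hU => (hρpos U hU).2.ne'))
  have hIh0 : Integrable (fun z => wNum F γ b₀ p₀ j Ts ρ ρ' Φ J 0 V z * h z) τ := by
    have e : (fun z => wNum F γ b₀ p₀ j Ts ρ ρ' Φ J 0 V z * h z)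
        = fun z => mwCut F γ b₀ p₀ j Ts (Φ (V, z)) * (ρ' Ts (Φ (V, z)) * (Real.log (ρ Ts (Φ (V, z))) - Real.log (ρ' Ts (Φ (V, z))))) * (J (V, z) : ℝ) := by
      funext z
      simp only [wNum, hh, Real.rpow_eq_pow, Real.rpow_zero, sub_zero, Real.rpow_one, one_mul]
      ring
    rw [e]
    exact integrable_mwCut_mul_comp_mul F γ b₀ p₀ j Ts hjTs hθ hχc hχsupp τ Φ J hΦm hJm CJ hJle _ hg0 V
  have hIh1 : Integrable (fun z => wNum F γ b₀ p₀ j Ts ρ ρ' Φ J 1 V z * h z) τ := by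
    have e : (fun z => wNum F γ b₀ p₀ j Ts ρ ρ' Φ J 1 V z * h z)
        = fun z => mwCut F γ b₀ p₀ j Ts (Φ (V, z)) * (ρ Ts (Φ (V, z)) * (Real.log (ρ Ts (Φ (V, z))) - Real.log (ρ' Ts (Φ (V, z))))) * (J (V, z) : ℝ) := by
      funext z
      simp only [wNum, hh, Real.rpow_eq_pow, Real.rpow_zero, sub_self, Real.rpow_one, mul_one]
      ring
    rw [e]
    exact integrable_mwCut_mul_comp_mul F γ b₀ p₀ j Ts hjTs hθ hχc hχsupp τ Φ J hΦm hJm CJ hJle _ hg1 V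
  -- `ŵ_s`-masses as ratios
  have hG : ∀ s : ℝ, ∫ z in A, wgt F γ b₀ p₀ j Ts ρ ρ' τ Φ J s V z ∂τ
      = (∫ z in A, wNum F γ b₀ p₀ j Ts ρ ρ' Φ J s V z ∂τ) / ∫ z, wNum F γ b₀ p₀ j Ts ρ ρ' Φ J s V z ∂τ := by
    intro s
    simp only [wgt]
    rw [integral_div]
  -- measurability of the base weights
  have hΦm1 : Measurable fun z => Φ (V, z) := hΦm.comp (measurable_const.prodMk measurable_id)
  have hJm1 : Measurable fun z => (J (V, z) : ℝ) := (hJm.comp (measurable_const.prodMk measurable_id)).coe_nnreal_real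
  have hwm : ∀ s : ℝ, Measurable fun z => wNum F γ b₀ p₀ j Ts ρ ρ' Φ J s V z := by
    intro s
    have e : (fun z => wNum F γ b₀ p₀ j Ts ρ ρ' Φ J s V z)
        = fun z => mwCut F γ b₀ p₀ j Ts (Φ (V, z)) * (ρ Ts (Φ (V, z)) ^ s * ρ' Ts (Φ (V, z)) ^ (1 - s)) * (J (V, z) : ℝ) := by
      funext z; simp only [wNum, Real.rpow_eq_pow]
    rw [e]
    exact ((hχc.measurable.comp hΦm1).mul (((hρm.comp hΦm1).pow_const s).mul ((hρ'm.comp hΦm1).pow_const (1 - s)))).mul hJm1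
  -- FIRST CALL: base weight `wNum₀`, tilt `h`, parameter `t`
  set w0 : Z → ℝ≥0 := fun z => (wNum F γ b₀ p₀ j Ts ρ ρ' Φ J 0 V z).toNNReal with hw0
  have hw0c : ∀ z, (w0 z : ℝ) = wNum F γ b₀ p₀ j Ts ρ ρ' Φ J 0 V z := fun z => Real.coe_toNNReal _ (hnn 0 V z)
  have hw0m : Measurable w0 := (hwm 0).real_toNNReal
  have hw0i : Integrable (fun z => (w0 z : ℝ)) τ := by simp_rw [hw0c]; exact hI0
  have hw0h : Integrable (fun z => (w0 z : ℝ) * h z) τ := by simp_rw [hw0c]; exact hIh0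
  have hw0e : Integrable (fun z => (w0 z : ℝ) * Real.exp (h z)) τ := by simp_rw [hw0c, ← hp10]; exact hI1
  have hw0p : 0 < ∫ z, (w0 z : ℝ) ∂τ := by simp_rw [hw0c]; exact hP0
  have hB0 := weightedTiltedMass_le τ hw0m hw0i hw0h hw0e hw0p hA ht0 ht1
  simp_rw [hw0c, ← hp10, ← hpt0] at hB0
  -- SECOND CALL: base weight `wNum₁`, tilt `−h`, parameter `1 − t`
  set w1 : Z → ℝ≥0 := fun z => (wNum F γ b₀ p₀ j Ts ρ ρ' Φ J 1 V z).toNNReal with hw1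
  have hw1c : ∀ z, (w1 z : ℝ) = wNum F γ b₀ p₀ j Ts ρ ρ' Φ J 1 V z := fun z => Real.coe_toNNReal _ (hnn 1 V z)
  have hw1m : Measurable w1 := (hwm 1).real_toNNReal
  have hw1i : Integrable (fun z => (w1 z : ℝ)) τ := by simp_rw [hw1c]; exact hI1
  have hw1h : Integrable (fun z => (w1 z : ℝ) * -h z) τ := by simp_rw [hw1c, mul_neg]; exact hIh1.neg
  have hw1e : Integrable (fun z => (w1 z : ℝ) * Real.exp (-h z)) τ := by simp_rw [hw1c, ← hp01]; exact hI0
  have hw1p : 0 < ∫ z, (w1 z : ℝ) ∂τ := by simp_rw [hw1c]; exact hP1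
  have h1t0 : 0 ≤ 1 - t := by linarith
  have h1t1 : 1 - t ≤ 1 := by linarith
  have hB1 := weightedTiltedMass_le τ hw1m hw1i hw1h hw1e hw1p hA h1t0 h1t1
  simp_rw [hw1c, ← hp01, ← hpt1] at hB1
  -- assemble
  rw [hG t, hG 0, hG 1]
  set a : ℝ := (∫ z in A, wNum F γ b₀ p₀ j Ts ρ ρ' Φ J 0 V z ∂τ) / ∫ z, wNum F γ b₀ p₀ j Ts ρ ρ' Φ J 0 V z ∂τ with ha
  set b : ℝ := (∫ z in A, wNum F γ b₀ p₀ j Ts ρ ρ' Φ J 1 V z ∂τ) / ∫ z, wNum F γ b₀ p₀ j Ts ρ ρ' Φ J 1 V z ∂τ with hb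
  have ha0 : 0 ≤ a := div_nonneg (setIntegral_nonneg hA fun z _ => hnn 0 V z) hP0.le
  have hb0 : 0 ≤ b := div_nonneg (setIntegral_nonneg hA fun z _ => hnn 1 V z) hP1.le
  have hm0 : 0 ≤ max a b := le_max_of_le_left ha0
  -- geometric means ≤ max
  have hgm0 : a ^ (1 - t) * b ^ t ≤ max a b := by
    calc a ^ (1 - t) * b ^ t ≤ (max a b) ^ (1 - t) * (max a b) ^ t :=
          mul_le_mul (Real.rpow_le_rpow ha0 (le_max_left _ _) h1t0) (Real.rpow_le_rpow hb0 (le_max_right _ _) ht0)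
            (Real.rpow_nonneg hb0 _) (Real.rpow_nonneg hm0 _)
      _ = max a b := by rw [← Real.rpow_add' hm0 (by norm_num : (1 - t) + t ≠ 0)]; norm_num
  have hgm1 : b ^ (1 - (1 - t)) * a ^ (1 - t) ≤ max a b := by
    rw [sub_sub_cancel, mul_comm]; exact hgm0
  -- the two one-sided bounds
  have hJ1 : ∫ z, wNum F γ b₀ p₀ j Ts ρ ρ' Φ J 1 V z * -h z ∂τ = -∫ z, wNum F γ b₀ p₀ j Ts ρ ρ' Φ J 1 V z * h z ∂τ := by
    rw [← integral_neg]; exact integral_congr_ae (Eventually.of_forall fun z => by simp only [mul_neg])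
  rw [hJ1, neg_div, sub_neg_eq_add] at hB1
  have hE0 := hB0.trans (mul_le_mul_of_nonneg_right hgm0 (Real.exp_pos _).le)
  have hE1 := hB1.trans (mul_le_mul_of_nonneg_right hgm1 (Real.exp_pos _).le)
  rcases min_choice
      (t * (Real.log ((∫ z, wNum F γ b₀ p₀ j Ts ρ ρ' Φ J 1 V z ∂τ) / ∫ z, wNum F γ b₀ p₀ j Ts ρ ρ' Φ J 0 V z ∂τ)
        - (∫ z, wNum F γ b₀ p₀ j Ts ρ ρ' Φ J 0 V z * h z ∂τ) / ∫ z, wNum F γ b₀ p₀ j Ts ρ ρ' Φ J 0 V z ∂τ))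
      ((1 - t) * (Real.log ((∫ z, wNum F γ b₀ p₀ j Ts ρ ρ' Φ J 0 V z ∂τ) / ∫ z, wNum F γ b₀ p₀ j Ts ρ ρ' Φ J 1 V z ∂τ)
        + (∫ z, wNum F γ b₀ p₀ j Ts ρ ρ' Φ J 1 V z * h z ∂τ) / ∫ z, wNum F γ b₀ p₀ j Ts ρ ρ' Φ J 1 V z ∂τ)) with hmin | hmin
  · rw [hmin]; exact hE0
  · rw [hmin]; exact hE1

end Summit.QuantumFields.YangMills.Theorems.OrganTangentGoodSetTailAlongPath

end
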